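import Summits.MatrixMultiplication.MatrixMultiplication.Theorems.FarEdgeDescentSummableDefect
import HarnessLib

/-!
# Route `FarEdgeDescent` — THE DIAL IS TWO-SIDED: past the summable endpoint the exact cuts continue by TRADING
special-side strength — a factorial floor under an exponentially growing doubling defect, the exact cut
`ω = 2 ⟺ SuperFactorialContact ∧ ExpDoublingDefect`, and the SANDWICH of laws between residuals — all PROVED

decomp-mm ROOT cell (D-0178), lens 2 «structural dichotomy: special vs generic», gen 20.  Notation:
`e(x) := ω(1,x,1) − (x+1) ≥ 0` (excess on the real shape axis `⟨n,n^x,n⟩`), `w := e(1) = ω − 2`, `s := 3 − ω ≥ 0`.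
Gen 19 (`FarEdgeDescentSummableDefect`, `…SummableWorlds`) showed that WITH THE PARTNER `SuperExpContact` = SEC
(stmt-28901: contact below every exponential rate) the generic dial `ALC (28900) ⟹ BDD (26556) ⟹ SLD (27344)` stops
at the summable envelope (the `ℓ¹` threshold is sharp: the gamma world).  This file shows the dial does not stop —
it has TWO knobs.  The next generic notch, the aside `ExpDoublingDefect` = EDD (stmt-27702, route rev 12; `∃ C A, ∀ m > 1,
e(m)² ≤ C·e^{A(m−1)}·(ω−2)·e(2m−1)`: the doubling defect may grow EXPONENTIALLY in the shape — dyadically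
`log C_i = O(2^i)`, exactly the gamma world's growth), still prices to a floor — now `e(k) ≥ exp(−c·k·log k)` —
and still decides the summit, against the matching STRONGER special leaf, the aside `SuperFactorialContact` =
SFC (stmt-27703; `∀ c > 0 ∃ k ≥ 2, e(k) < exp(−c·k·log k)`: contact below every factorial rate; `FiniteSaturation ⟹ SFC ⟹ SEC`).
* §0 **ENGINE (abstract, PROVED).**  Line + law with defect `C·e^{A(m−1)}` ⟹ along the halving orbit
  `m_j = 1 + (K−1)/2^j` the level-`j` defect is `D_j = C·exp(A(K−1)/2^{j+1})` and EVERY LEVEL PAYS THE SAME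
  `A(K−1)/2`: the price is `(2^J − 1)·log C + J·A(K−1)/2` at the stopping depth `2^J ≤ 4a + 2`, `a = (s/w)(K−1)`
  (`orbit_floor_expDefect`); `J = O(log K)`, hence `E(k) ≥ exp(−c·k·log k)` at every `k ≥ 2`
  (`factorialFloor_expDefect`).  (Rate `k·log k` sharp: the gamma world, companion file.)
* §1 **TRUE EXPONENTS (PROVED).**  `EDD ∧ ω > 2 ⟹ ∃ c > 0 ∀ k ≥ 2, e(k) ≥ exp(−c·k·log k)`
  (`factorialFloor_of_edd`); and `ω > 2 ∧ (∀ k ≥ 2, e(k) ≥ ρ^k) ⟹ EDD` with explicit constants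
  (`edd_of_geometricFloor`: `e(m) ≤ e(1) = w` and `e(2m−1) ≥ e(⌈2m−1⌉) ≥ ρ^⌈2m−1⌉`, `⌈2m−1⌉ < 2m`).
* §2 **BY NAME (PROVED).**  `closes_eddSfc : SuperFactorialContact → ExpDoublingDefect → ω = 2`, `closes_eddFs`,
  exactness `node_eddSfc_iff` / `node_eddFs_iff`, necessity `edd_of_mm`, `sfc_of_mm`, the notches `edd_of_bdd`,
  `edd_of_sld`, `sfc_of_fs`, and THE SANDWICH `edd_of_secResidual : (SuperExpContact → S) → ExpDoublingDefect`:
  modulo `ω = 2` the laws and the bare residuals INTERLEAVE, `SLD ⟹ (SEC → S) ⟹ EDD ⟹ (SFC → S)` (`dial_chain₅`) —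
  each law sits between two consecutive residuals, each exact cut pairs a law with the contact leaf its floor
  can read.  Placement `SFC ⟹ SEC`, the residual law of SFC and the separating model worlds (gamma: the mixed pair
  (SEC, EDD) is no cut; Gaussian: EDD is load-bearing; exponential: no fixed rate) are in `FarEdgeDescentContactScale`.

Imports only the BUILT module `FarEdgeDescentSummableDefect`; no definitions; restates nothing (re-uses
`stopped_orbit`, `anchorLine_le_excess`, `excess_antitone`, `residual_iff_expFloorLaw`, `closes_sldSec`, `bdd_of_mm`).
[cite: LottiRomani1983, §1 (p. 173), §2 (p. 174)] [cite: Coppersmith1982] [cite: HuangPan1998, §8]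
-/

set_option linter.dupNamespace false

noncomputable section

namespace Summit.MatrixMultiplication.MatrixMultiplication.Theorems.FarEdgeDescentTradeoff

open Literature.Computability.AlgebraicComplexity
open Summit.MatrixMultiplication.MatrixMultiplication.Theses.FarEdgeDescent
open Summit.MatrixMultiplication.MatrixMultiplication.Theorems.FarEdgeDescentChord
open Summit.MatrixMultiplication.MatrixMultiplication.Theorems.FarEdgeDescentExpFloor
open Summit.MatrixMultiplication.MatrixMultiplication.Theorems.FarEdgeDescentDefectDial
open Summit.MatrixMultiplication.MatrixMultiplication.Theorems.FarEdgeDescentSummableDefect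
open Finset

/-! ## §0 The abstract engine under an exponentially growing doubling defect -/

/-- **Orbit floor under an exponentially growing defect (abstract, PROVED).**  A profile `E` on `[1,∞)` with
the line `E(m) ≥ w − s(m−1)` (`w > 0`, `s ≥ 0`) and the law `E(m)² ≤ C·exp(A(m−1))·w·E(2m−1)` for `m > 1`
(`C ≥ 1`, `A ≥ 0`) has, for every `K > 1`, a stopping depth `J` with `2^J ≤ 4a + 2`, `a := (s/w)(K−1)`, and
`E(K) ≥ w·exp(−[(4a+2)·log(2C) + (A(K−1)/2)·J])`: along the halving orbit the defects are
`D_j = C·exp(A(K−1)/2^{j+1})`, and `Σ_{j<J} 2^j·log D_j = (2^J − 1)·log C + J·A(K−1)/2` — each LEVEL of the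
orbit pays the same `A(K−1)/2`, so the price is `log K` levels times a term linear in `K`. -/
theorem orbit_floor_expDefect {E : ℝ → ℝ} {w s C A K : ℝ} (hw : 0 < w) (hs : 0 ≤ s) (hC : 1 ≤ C)
    (hlin : ∀ m : ℝ, 1 ≤ m → w - s * (m - 1) ≤ E m)
    (hlaw : ∀ m : ℝ, 1 < m → E m ^ 2 ≤ C * Real.exp (A * (m - 1)) * w * E (2 * m - 1)) (hK : 1 < K) :
    ∃ J : ℕ, (2 : ℝ) ^ J ≤ 4 * (s / w * (K - 1)) + 2 ∧
      w * Real.exp (-((4 * (s / w * (K - 1)) + 2) * Real.log (2 * C) + A * (K - 1) / 2 * J)) ≤ E K := by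
  have hC0 : 0 < C := by linarith
  set D : ℕ → ℝ := fun j => C * Real.exp (A * (K - 1) / 2 ^ (j + 1)) with hD
  have hDpos : ∀ j, 0 < D j := fun j => mul_pos hC0 (Real.exp_pos _)
  have hD0 : ∀ j, 0 ≤ D j := fun j => (hDpos j).le
  have hAD : ∀ j : ℕ, E (1 + (K - 1) / 2 ^ (j + 1)) ^ 2 ≤ D j * w * E (1 + (K - 1) / 2 ^ j) := by
    intro j
    have h2j : (0 : ℝ) < 2 ^ (j + 1) := pow_pos two_pos _
    have hm : 1 < 1 + (K - 1) / 2 ^ (j + 1) := by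
      have := div_pos (sub_pos.2 hK) h2j
      linarith
    have h := hlaw _ hm
    have e1 : 2 * (1 + (K - 1) / 2 ^ (j + 1)) - 1 = 1 + (K - 1) / 2 ^ j := by
      rw [pow_succ]; field_simp; ring
    have e2 : A * (1 + (K - 1) / 2 ^ (j + 1) - 1) = A * (K - 1) / 2 ^ (j + 1) := by ring
    rw [e1, e2] at h
    exact h
  obtain ⟨J, hJ, hfloor⟩ := stopped_orbit hw hs hK hD0 hlin hAD
  refine ⟨J, hJ, ?_⟩
  have hP : 0 < ∏ j ∈ range J, D j ^ 2 ^ j := prod_pos fun j _ => pow_pos (hDpos j) _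
  have hlogD : ∀ j, Real.log (D j) = Real.log C + A * (K - 1) / 2 ^ (j + 1) := fun j => by
    show Real.log (C * Real.exp (A * (K - 1) / 2 ^ (j + 1))) = _
    rw [Real.log_mul hC0.ne' (Real.exp_pos _).ne', Real.log_exp]
  have hlogP : Real.log (∏ j ∈ range J, D j ^ 2 ^ j) =
      ∑ j ∈ range J, ((2 : ℝ) ^ j * Real.log C + A * (K - 1) / 2) := by
    rw [Real.log_prod (fun j _ => (pow_pos (hDpos j) _).ne')]
    refine sum_congr rfl fun j _ => ?_
    rw [Real.log_pow, hlogD, pow_succ]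
    push_cast
    have h2j : (2 : ℝ) ^ j ≠ 0 := pow_ne_zero _ two_ne_zero
    field_simp
  have hsum : ∑ j ∈ range J, ((2 : ℝ) ^ j * Real.log C + A * (K - 1) / 2) =
      (2 ^ J - 1) * Real.log C + J * (A * (K - 1) / 2) := by
    rw [sum_add_distrib, ← sum_mul, geom_sum_eq (by norm_num : (2 : ℝ) ≠ 1), sum_const, card_range,
      nsmul_eq_mul]
    ring
  have hlogC : 0 ≤ Real.log C := Real.log_nonneg hC
  have hlogP_le : Real.log (∏ j ∈ range J, D j ^ 2 ^ j) ≤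
      (4 * (s / w * (K - 1)) + 2) * Real.log C + A * (K - 1) / 2 * J := by
    rw [hlogP, hsum]
    have h1 : ((2 : ℝ) ^ J - 1) * Real.log C ≤ (4 * (s / w * (K - 1)) + 2) * Real.log C :=
      mul_le_mul_of_nonneg_right (by linarith) hlogC
    have h2 : (J : ℝ) * (A * (K - 1) / 2) = A * (K - 1) / 2 * J := by ring
    linarith
  have hEK : w * Real.exp (-((4 * (s / w * (K - 1)) + 2) * Real.log 2)) /
      (∏ j ∈ range J, D j ^ 2 ^ j) ≤ E K := by
    rw [div_le_iff₀ hP]; exact hfloor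
  have esplit : Real.exp (-((4 * (s / w * (K - 1)) + 2) * Real.log (2 * C) + A * (K - 1) / 2 * J)) =
      Real.exp (-((4 * (s / w * (K - 1)) + 2) * Real.log 2)) *
        Real.exp (-((4 * (s / w * (K - 1)) + 2) * Real.log C + A * (K - 1) / 2 * J)) := by
    rw [← Real.exp_add, Real.log_mul two_ne_zero hC0.ne']
    congr 1
    ring
  calc w * Real.exp (-((4 * (s / w * (K - 1)) + 2) * Real.log (2 * C) + A * (K - 1) / 2 * J))
      = w * Real.exp (-((4 * (s / w * (K - 1)) + 2) * Real.log 2)) *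
          Real.exp (-((4 * (s / w * (K - 1)) + 2) * Real.log C + A * (K - 1) / 2 * J)) := by
        rw [esplit, mul_assoc]
    _ ≤ w * Real.exp (-((4 * (s / w * (K - 1)) + 2) * Real.log 2)) *
          Real.exp (-Real.log (∏ j ∈ range J, D j ^ 2 ^ j)) := by
        apply mul_le_mul_of_nonneg_left _ (by positivity)
        rw [Real.exp_le_exp]
        linarith [hlogP_le]
    _ = w * Real.exp (-((4 * (s / w * (K - 1)) + 2) * Real.log 2)) / (∏ j ∈ range J, D j ^ 2 ^ j) := by
        rw [Real.exp_neg (Real.log _), Real.exp_log hP]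
        simp only [div_eq_mul_inv]
    _ ≤ E K := hEK

/-- **Factorial floor (abstract, PROVED).**  Under the hypotheses of `orbit_floor_expDefect`:
`∃ c > 0, ∀ k ≥ 2, E(k) ≥ exp(−c·k·log k)` — the stopping depth is `J ≤ log₂((4(s/w)+2)·k)`, so the price
`(4a+2)·log(2C) + (A(k−1)/2)·J` is `O(k·log k)`.  (Rate sharp: the gamma world, companion file.) -/
theorem factorialFloor_expDefect {E : ℝ → ℝ} {w s C A : ℝ} (hw : 0 < w) (hs : 0 ≤ s) (hC : 1 ≤ C)
    (hA : 0 ≤ A) (hlin : ∀ m : ℝ, 1 ≤ m → w - s * (m - 1) ≤ E m)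
    (hlaw : ∀ m : ℝ, 1 < m → E m ^ 2 ≤ C * Real.exp (A * (m - 1)) * w * E (2 * m - 1)) :
    ∃ c : ℝ, 0 < c ∧ ∀ k : ℕ, 2 ≤ k → Real.exp (-(c * k * Real.log k)) ≤ E k := by
  have hl2 : 0 < Real.log 2 := Real.log_pos one_lt_two
  have hsw : 0 ≤ s / w := div_nonneg hs hw.le
  have hβ2 : (2 : ℝ) ≤ 4 * (s / w) + 2 := by linarith
  have hβ0 : (0 : ℝ) < 4 * (s / w) + 2 := by linarith
  have hlogβ : 0 ≤ Real.log (4 * (s / w) + 2) := Real.log_nonneg (by linarith)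
  have hlog2C : 0 ≤ Real.log (2 * C) := Real.log_nonneg (by linarith)
  set Q : ℝ := (4 * (s / w) + 2) * Real.log (2 * C) + A / (2 * Real.log 2) * Real.log (4 * (s / w) + 2) +
    |Real.log w| with hQ
  have hQ0 : 0 ≤ Q := by
    rw [hQ]
    have h1 : 0 ≤ (4 * (s / w) + 2) * Real.log (2 * C) := mul_nonneg hβ0.le hlog2C
    have h2 : 0 ≤ A / (2 * Real.log 2) * Real.log (4 * (s / w) + 2) :=
      mul_nonneg (div_nonneg hA (by linarith)) hlogβ
    have h3 : 0 ≤ |Real.log w| := abs_nonneg _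
    linarith
  refine ⟨Q / Real.log 2 + A / (2 * Real.log 2) + 1, by positivity, fun k hk => ?_⟩
  have hk2 : (2 : ℝ) ≤ k := by exact_mod_cast hk
  have hk1 : (1 : ℝ) < k := by linarith
  have hkpos : (0 : ℝ) < k := by linarith
  have hℓ : Real.log 2 ≤ Real.log k := Real.log_le_log two_pos hk2
  have hℓ0 : 0 ≤ Real.log k := hl2.le.trans hℓ
  have hℓ1 : 1 ≤ Real.log k / Real.log 2 := by rw [le_div_iff₀ hl2, one_mul]; exact hℓ
  obtain ⟨J, hJ, hfl⟩ := orbit_floor_expDefect hw hs hC hlin hlaw hk1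
  -- the stopping depth is logarithmic: `J·log 2 ≤ log(4(s/w)+2) + log k`
  have hF1 : 4 * (s / w * ((k : ℝ) - 1)) + 2 ≤ (4 * (s / w) + 2) * k := by nlinarith
  have h2J : (0 : ℝ) < 2 ^ J := pow_pos two_pos J
  have hJlog : (J : ℝ) * Real.log 2 ≤ Real.log (4 * (s / w) + 2) + Real.log k := by
    have h := Real.log_le_log h2J (hJ.trans hF1)
    rw [Real.log_pow, Real.log_mul hβ0.ne' hkpos.ne'] at h
    exact h
  have hJle : (J : ℝ) ≤ (Real.log (4 * (s / w) + 2) + Real.log k) / Real.log 2 := by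
    rw [le_div_iff₀ hl2]; exact hJlog
  have hJ0 : (0 : ℝ) ≤ J := J.cast_nonneg
  -- the price of the orbit is `O(k log k)`
  have hT1 : (4 * (s / w * ((k : ℝ) - 1)) + 2) * Real.log (2 * C) ≤ (4 * (s / w) + 2) * k * Real.log (2 * C) :=
    mul_le_mul_of_nonneg_right hF1 hlog2C
  have hT2 : A * ((k : ℝ) - 1) / 2 * J ≤ A * k / 2 * ((Real.log (4 * (s / w) + 2) + Real.log k) / Real.log 2) := by
    have h1 : A * ((k : ℝ) - 1) / 2 * J ≤ A * k / 2 * J := by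
      apply mul_le_mul_of_nonneg_right _ hJ0
      have := mul_nonneg hA (show (0 : ℝ) ≤ 1 from zero_le_one)
      nlinarith
    exact h1.trans (mul_le_mul_of_nonneg_left hJle (by positivity))
  have hG1 : Q * k ≤ Q * (k * (Real.log k / Real.log 2)) :=
    mul_le_mul_of_nonneg_left (le_mul_of_one_le_right hkpos.le hℓ1) hQ0
  have hG2 : |Real.log w| ≤ |Real.log w| * k := le_mul_of_one_le_right (abs_nonneg _) hk1.le
  have hG3 : 0 ≤ (k : ℝ) * Real.log k := mul_nonneg hkpos.le hℓ0
  have hlogw : -Real.log w ≤ |Real.log w| := neg_le_abs _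
  have hmain : (4 * (s / w * ((k : ℝ) - 1)) + 2) * Real.log (2 * C) + A * ((k : ℝ) - 1) / 2 * J - Real.log w ≤
      (Q / Real.log 2 + A / (2 * Real.log 2) + 1) * k * Real.log k := by
    have e1 : (Q / Real.log 2 + A / (2 * Real.log 2) + 1) * k * Real.log k =
        Q * (k * (Real.log k / Real.log 2)) + A * k / 2 * (Real.log k / Real.log 2) + k * Real.log k := by
      field_simp
    have e2 : Q * k = (4 * (s / w) + 2) * k * Real.log (2 * C) +
        A * k / 2 * (Real.log (4 * (s / w) + 2) / Real.log 2) + |Real.log w| * k := by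
      rw [hQ]; field_simp
    have e3 : A * (k : ℝ) / 2 * ((Real.log (4 * (s / w) + 2) + Real.log k) / Real.log 2) =
        A * k / 2 * (Real.log (4 * (s / w) + 2) / Real.log 2) + A * k / 2 * (Real.log k / Real.log 2) := by
      field_simp
    rw [e1]
    linarith [hT1, hT2, hG1, hG2, hG3, hlogw, e2, e3]
  have hwexp : w = Real.exp (Real.log w) := (Real.exp_log hw).symm
  calc Real.exp (-((Q / Real.log 2 + A / (2 * Real.log 2) + 1) * k * Real.log k))
      ≤ Real.exp (Real.log w) *
          Real.exp (-((4 * (s / w * ((k : ℝ) - 1)) + 2) * Real.log (2 * C) + A * ((k : ℝ) - 1) / 2 * J)) := by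
        rw [← Real.exp_add, Real.exp_le_exp]
        linarith [hmain]
    _ = w * Real.exp (-((4 * (s / w * ((k : ℝ) - 1)) + 2) * Real.log (2 * C) + A * ((k : ℝ) - 1) / 2 * J)) := by
        rw [← hwexp]
    _ ≤ E k := hfl

/-! ## §1 At the true exponents: the factorial floor under an exponential doubling defect -/

/-- The defect constants can be RAISED: `(C, A) ↦ (max C 1, max A 0)` (both excesses `≥ 0`). -/
theorem edd_mono {C A : ℝ}
    (hE : ∀ m : ℝ, 1 < m → (omegaRect ℂ 1 m 1 - (m + 1)) ^ 2 ≤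
      C * Real.exp (A * (m - 1)) * (omegaRect ℂ 1 1 1 - 2) * (omegaRect ℂ 1 (2 * m - 1) 1 - 2 * m)) :
    ∀ m : ℝ, 1 < m → (omegaRect ℂ 1 m 1 - (m + 1)) ^ 2 ≤
      max C 1 * Real.exp (max A 0 * (m - 1)) * (omegaRect ℂ 1 1 1 - 2) * (omegaRect ℂ 1 (2 * m - 1) 1 - 2 * m) := by
  intro m hm
  refine (hE m hm).trans (mul_le_mul_of_nonneg_right (mul_le_mul_of_nonneg_right ?_ excess_one_nonneg)
    (excess_nonneg_two m))
  have h1 : C * Real.exp (A * (m - 1)) ≤ max C 1 * Real.exp (A * (m - 1)) :=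
    mul_le_mul_of_nonneg_right (le_max_left _ _) (Real.exp_pos _).le
  have h2 : Real.exp (A * (m - 1)) ≤ Real.exp (max A 0 * (m - 1)) :=
    Real.exp_le_exp.2 (mul_le_mul_of_nonneg_right (le_max_left _ _) (by linarith))
  exact h1.trans (mul_le_mul_of_nonneg_left h2 (le_trans zero_le_one (le_max_right _ _)))

/-- **FACTORIAL FLOOR under an exponential doubling defect (PROVED).**  If `e(m)² ≤ C·exp(A(m−1))·(ω−2)·e(2m−1)`
for all real `m > 1` and `ω > 2`, then `∃ c > 0, e(k) ≥ exp(−c·k·log k)` at every integer `k ≥ 2`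
(anchor line = Lotti–Romani convexity, `anchorLine_le_excess`). -/
theorem factorialFloor_of_edd {C A : ℝ}
    (hE : ∀ m : ℝ, 1 < m → (omegaRect ℂ 1 m 1 - (m + 1)) ^ 2 ≤
      C * Real.exp (A * (m - 1)) * (omegaRect ℂ 1 1 1 - 2) * (omegaRect ℂ 1 (2 * m - 1) 1 - 2 * m))
    (hω : 2 < omega ℂ) :
    ∃ c : ℝ, 0 < c ∧ ∀ k : ℕ, 2 ≤ k → Real.exp (-(c * k * Real.log k)) ≤ omegaRect ℂ 1 k 1 - (k + 1) := by
  have hw : 0 < omega ℂ - 2 := sub_pos.2 hω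
  have hE' := edd_mono hE
  refine factorialFloor_expDefect (E := fun m => omegaRect ℂ 1 m 1 - (m + 1)) hw
    (by linarith [omega_le_three' (K := ℂ)]) (le_max_right C 1) (le_max_right A 0)
    (fun m hm => anchorLine_le_excess hm) (fun m hm => ?_)
  have h := hE' m hm
  rw [omegaRect_one_one_one] at h
  have e : (2 : ℝ) * m - 1 + 1 = 2 * m := by ring
  show (omegaRect ℂ 1 m 1 - (m + 1)) ^ 2 ≤
    max C 1 * Real.exp (max A 0 * (m - 1)) * (omega ℂ - 2) * (omegaRect ℂ 1 (2 * m - 1) 1 - (2 * m - 1 + 1))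
  rw [e]; exact h

/-- **A geometric floor already gives an exponential doubling defect (PROVED).**  If `ω > 2` and
`e(k) ≥ ρ^k` at every integer `k ≥ 2` (`ρ > 0`), then `e(m)² ≤ C·exp(A(m−1))·(ω−2)·e(2m−1)` for all real
`m > 1` with `C = (ω−2)/ρ'²`, `A = −2·log ρ'`, `ρ' = min ρ 1`: `e(m) ≤ e(1) = ω − 2` (monotonicity) and
`e(2m−1) ≥ e(⌈2m−1⌉) ≥ ρ'^⌈2m−1⌉ ≥ ρ'^{2m}`. -/
theorem edd_of_geometricFloor (hω : 2 < omega ℂ) {ρ : ℝ} (hρ : 0 < ρ)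
    (hfloor : ∀ k : ℕ, 2 ≤ k → ρ ^ k ≤ omegaRect ℂ 1 k 1 - (k + 1)) :
    ∀ m : ℝ, 1 < m → (omegaRect ℂ 1 m 1 - (m + 1)) ^ 2 ≤
      (omega ℂ - 2) / (min ρ 1) ^ 2 * Real.exp (-2 * Real.log (min ρ 1) * (m - 1)) *
        (omegaRect ℂ 1 1 1 - 2) * (omegaRect ℂ 1 (2 * m - 1) 1 - 2 * m) := by
  intro m hm
  set r : ℝ := min ρ 1 with hr
  have hr0 : 0 < r := lt_min hρ one_pos
  have hr1 : r ≤ 1 := min_le_right _ _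
  have hlogr : Real.log r ≤ 0 := Real.log_nonpos hr0.le hr1
  have hw : 0 < omega ℂ - 2 := sub_pos.2 hω
  -- the integer shape just beyond `2m − 1`
  set k : ℕ := ⌈(2 : ℝ) * m - 1⌉₊ with hk
  have hkge : 2 * m - 1 ≤ (k : ℝ) := Nat.le_ceil _
  have hklt : (k : ℝ) < 2 * m - 1 + 1 := Nat.ceil_lt_add_one (by linarith)
  have hk2 : 2 ≤ k := by
    have : (1 : ℝ) < k := by linarith
    have : 1 < k := by exact_mod_cast this
    omega
  have hek : r ^ k ≤ omegaRect ℂ 1 k 1 - (k + 1) :=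
    (pow_le_pow_left₀ hr0.le (min_le_left _ _) k).trans (hfloor k hk2)
  have hmono : omegaRect ℂ 1 k 1 - ((k : ℝ) + 1) ≤ omegaRect ℂ 1 (2 * m - 1) 1 - 2 * m := by
    have h := excess_antitone (x := (k : ℝ)) (y := 2 * m - 1) hkge
    have e : (2 : ℝ) * m - 1 + 1 = 2 * m := by ring
    rw [e] at h
    exact h
  have hlow : Real.exp ((k : ℝ) * Real.log r) ≤ omegaRect ℂ 1 (2 * m - 1) 1 - 2 * m := by
    rw [Real.exp_nat_mul, Real.exp_log hr0]
    exact hek.trans hmono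
  -- the excess is at most the anchor value
  have hup : omegaRect ℂ 1 m 1 - (m + 1) ≤ omega ℂ - 2 := by
    have h := excess_antitone (x := m) (y := 1) hm.le
    rw [omegaRect_one_one_one] at h
    linarith
  have hnn : 0 ≤ omegaRect ℂ 1 m 1 - (m + 1) := by
    have := add_one_le_omegaRect_one_mid_one ℂ m
    linarith
  have hsq : (omegaRect ℂ 1 m 1 - (m + 1)) ^ 2 ≤ (omega ℂ - 2) ^ 2 := pow_le_pow_left₀ hnn hup 2
  -- bookkeeping: `(ω−2)² ≤ ((ω−2)/r²)·exp(−2 log r·(m−1))·(ω−2)·exp(k·log r)` since `log r·(k − 2m) ≥ 0`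
  have hexp1 : 1 ≤ Real.exp (-2 * Real.log r * (m - 1)) * Real.exp ((k : ℝ) * Real.log r) / r ^ 2 := by
    have er : r ^ 2 = Real.exp (2 * Real.log r) := by
      rw [← Real.exp_log (pow_pos hr0 2), Real.log_pow]; norm_num
    rw [er, ← Real.exp_add, ← Real.exp_sub]
    apply Real.one_le_exp
    nlinarith [hlogr, hklt, hkge]
  rw [omegaRect_one_one_one]
  calc (omegaRect ℂ 1 m 1 - (m + 1)) ^ 2 ≤ (omega ℂ - 2) ^ 2 := hsq
    _ ≤ (omega ℂ - 2) ^ 2 * (Real.exp (-2 * Real.log r * (m - 1)) * Real.exp ((k : ℝ) * Real.log r) / r ^ 2) :=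
        le_mul_of_one_le_right (sq_nonneg _) hexp1
    _ = (omega ℂ - 2) / r ^ 2 * Real.exp (-2 * Real.log r * (m - 1)) * (omega ℂ - 2) *
          Real.exp ((k : ℝ) * Real.log r) := by
        field_simp
    _ ≤ (omega ℂ - 2) / r ^ 2 * Real.exp (-2 * Real.log r * (m - 1)) * (omega ℂ - 2) *
          (omegaRect ℂ 1 (2 * m - 1) 1 - 2 * m) :=
        mul_le_mul_of_nonneg_left hlow (by positivity)

/-! ## §2 By name over the route asides `ExpDoublingDefect` (EDD, stmt-MatrixMultiplication-27702) and
`SuperFactorialContact` (SFC, stmt-MatrixMultiplication-27703), route rev 12: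
the exact cut, necessity, the two-sided dial and the SANDWICH of laws between residuals -/

/-- The aside IS the exponential-defect law (definitional unfolding). -/
theorem expDoublingDefect_iff : ExpDoublingDefect ↔
    ∃ C A : ℝ, ∀ m : ℝ, 1 < m → (omegaRect ℂ 1 m 1 - (m + 1)) ^ 2 ≤
      C * Real.exp (A * (m - 1)) * (omegaRect ℂ 1 1 1 - 2) * (omegaRect ℂ 1 (2 * m - 1) 1 - 2 * m) :=
  Iff.rfl

/-- (definitional unfolding of the aside `SuperFactorialContact`) -/
theorem superFactorialContact_iff : SuperFactorialContact ↔
    ∀ c : ℝ, 0 < c → ∃ k : ℕ, 2 ≤ k ∧ omegaRect ℂ 1 k 1 - (k + 1) < Real.exp (-(c * k * Real.log k)) :=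
  Iff.rfl

/-- **DECIDING THEOREM of the traded cut (PROVED).**  `SuperFactorialContact → ExpDoublingDefect → ω(ℂ) = 2`:
if `ω > 2` the factorial floor of §1 meets superfactorial contact. -/
theorem closes_eddSfc (h₁ : SuperFactorialContact) (h₂ : ExpDoublingDefect) : _root_.MatrixMultiplication := by
  rw [_root_.MatrixMultiplication_iff]
  refine le_antisymm (not_lt.1 fun hω => ?_) (omega_two_le (K := ℂ))
  obtain ⟨C, A, hE⟩ := h₂
  obtain ⟨c, hc, hfloor⟩ := factorialFloor_of_edd hE hω
  obtain ⟨k, hk, hek⟩ := h₁ c hc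
  have := hfloor k hk
  linarith

/-- A far zero is superfactorial contact: `FiniteSaturation (23739) → SuperFactorialContact`. -/
theorem sfc_of_fs (h : FiniteSaturation) : SuperFactorialContact := by
  obtain ⟨k, hk, hsat⟩ := h
  intro c hc
  refine ⟨k, hk, ?_⟩
  rw [hsat, sub_self]
  exact Real.exp_pos _

/-- `FiniteSaturation → ExpDoublingDefect → ω = 2` (the zero form of the traded cut). -/
theorem closes_eddFs (h₁ : FiniteSaturation) (h₂ : ExpDoublingDefect) : _root_.MatrixMultiplication :=
  closes_eddSfc (sfc_of_fs h₁) h₂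

/-- One notch down the generic dial: `BoundedDoublingDefect (26556) → ExpDoublingDefect` (`A = 0`). -/
theorem edd_of_bdd (h : BoundedDoublingDefect) : ExpDoublingDefect := by
  obtain ⟨C, hC⟩ := h
  refine ⟨C, 0, fun m hm => ?_⟩
  rw [zero_mul, Real.exp_zero, mul_one]
  exact hC m hm

/-- Necessity: `ω = 2 → ExpDoublingDefect` (tag NEC). -/
theorem edd_of_mm (h : _root_.MatrixMultiplication) : ExpDoublingDefect :=
  edd_of_bdd (bdd_of_mm h)

/-- Necessity: `ω = 2 → SuperFactorialContact` (tag NEC). -/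
theorem sfc_of_mm (h : _root_.MatrixMultiplication) : SuperFactorialContact :=
  sfc_of_fs (finiteSaturation_of_mm h)

/-- **The traded cut is exact**: `ω(ℂ) = 2 ⟺ SuperFactorialContact ∧ ExpDoublingDefect`. -/
theorem node_eddSfc_iff : _root_.MatrixMultiplication ↔ SuperFactorialContact ∧ ExpDoublingDefect :=
  ⟨fun h => ⟨sfc_of_mm h, edd_of_mm h⟩, fun h => closes_eddSfc h.1 h.2⟩

/-- `ω(ℂ) = 2 ⟺ FiniteSaturation ∧ ExpDoublingDefect`. -/
theorem node_eddFs_iff : _root_.MatrixMultiplication ↔ FiniteSaturation ∧ ExpDoublingDefect :=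
  ⟨fun h => ⟨finiteSaturation_of_mm h, edd_of_mm h⟩, fun h => closes_eddFs h.1 h.2⟩

/-- **THE SANDWICH (PROVED): the bare residual of the OLD special leaf already implies the NEW law.**
`(SuperExpContact → ω = 2) → ExpDoublingDefect` — a geometric floor (`residual_iff_expFloorLaw`) is an
exponential doubling defect (`edd_of_geometricFloor`).  So modulo `ω = 2` the laws and the residuals
INTERLEAVE: `SLD ⟹ (SEC → S) ⟹ EDD ⟹ (SFC → S)`. -/
theorem edd_of_secResidual (h : SuperExpContact → _root_.MatrixMultiplication) : ExpDoublingDefect := by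
  rcases eq_or_lt_of_le (omega_two_le (K := ℂ)) with hω | hω
  · exact edd_of_mm (by rw [_root_.MatrixMultiplication_iff]; exact hω.symm)
  · obtain ⟨ρ, hρ, hfloor⟩ := residual_iff_expFloorLaw.1 h hω
    exact ⟨_, _, edd_of_geometricFloor hω hρ hfloor⟩

/-- **`SummableLogDefect (27344) → ExpDoublingDefect`**, through the sandwich: `SLD ⟹ (SuperExpContact → S)`
(`closes_sldSec`, gen 19) `⟹ EDD`.  (Directly: a summable dyadic envelope has `log C_i ≤ B·2^i`, so
`(C, A) = (e^{2B}, 2B)` is an exponential one.) -/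
theorem edd_of_sld (h : SummableLogDefect) : ExpDoublingDefect :=
  edd_of_secResidual fun h₁ => closes_sldSec h₁ h

/-- **The two-sided dial (PROVED chain).**  Generic side, one more notch DOWN — THROUGH the residual of the
old special leaf: `SummableLogDefect ⟹ (SuperExpContact → S) ⟹ ExpDoublingDefect ⟹ (SuperFactorialContact → S)`;
special side, one notch UP: `FiniteSaturation ⟹ SuperFactorialContact` (`⟹ SuperExpContact`, companion
`FarEdgeDescentContactScale.sec_of_sfc`).  Each exact cut pairs a law with the contact leaf its floor reads:
(SLD, SEC) [gen 19], (EDD, SFC) [this file]. -/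
theorem dial_chain₅ :
    (SummableLogDefect → SuperExpContact → _root_.MatrixMultiplication) ∧
      ((SuperExpContact → _root_.MatrixMultiplication) → ExpDoublingDefect) ∧
      (ExpDoublingDefect → SuperFactorialContact → _root_.MatrixMultiplication) ∧
      (FiniteSaturation → SuperFactorialContact) :=
  ⟨fun hS h₁ => closes_sldSec h₁ hS, edd_of_secResidual, fun hE h₁ => closes_eddSfc h₁ hE, sfc_of_fs⟩

end Summit.MatrixMultiplication.MatrixMultiplication.Theorems.FarEdgeDescentTradeoff

end
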